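import Mathlib
import Summits.Ventures.PercRepro2.FourTypedShard7

/-!
# Four typed edges: shards 13 / 13 (blind cell PercRepro2, night-3, 2026-08-24)

The kernel check of `allOk4` over lists of `a7`-slices (`sliceAll`, `decide +kernel`, sequential
elaboration): 2 groups, `2516` full checks,
`14071` leaves.
-/

set_option Elab.async false

namespace Summit.Ventures.PercRepro2

open UnionCluster

namespace CovForm

namespace TwoTyped

open OneTyped

set_option maxHeartbeats 0 in
/-- Slices `(1, 2, 3, 4, 5, 6, 2)` … `(1, 2, 3, 4, 5, 6, 3)` (`1267` full checks, `6945` leaves). -/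
theorem grp_132 : sliceAll
    [(1, 2, 3, 4, 5, 6, 2), (1, 2, 3, 4, 5, 6, 3)] = true := by
  decide +kernel

set_option maxHeartbeats 0 in
/-- Slices `(1, 2, 3, 4, 5, 6, 4)` … `(1, 2, 3, 4, 5, 6, 7)` (`1249` full checks, `7126` leaves). -/
theorem grp_133 : sliceAll
    [(1, 2, 3, 4, 5, 6, 4), (1, 2, 3, 4, 5, 6, 5), (1, 2, 3, 4, 5, 6, 6),
     (1, 2, 3, 4, 5, 6, 7)] = true := by
  decide +kernel

end TwoTyped

end CovForm

end Summit.Ventures.PercRepro2
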